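import Summits.BirchSwinnertonDyer.BirchSwinnertonDyer.Theorems.GenusKolyvaginAtTwoPowDvdShaCardAtTwoRTEigenIndexSocket
import HarnessLib

/-!
# Route `GenusKolyvaginAtTwo`, crux L⁺_T `PowDvdShaCardAtTwoPosT` (stmt-BirchSwinnertonDyer-23379; `2^(2M₀) ∣ #Ш(E/K)[2^∞]` on `Δ > 0`),
# road «E4⁺» (LEAD R10), socket hK⁺ — THE EIGEN INDEX LAW AT A REGULAR KOLYVAGIN PRIME: `Δ < 0` and Gross's (3.2)
# `Frob(ℓ) = Frob(∞)` replaced by «`Frob(ℓ)` is a regular involution of `E[2^L]` and complex conjugation on `K`»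

Seat `bsd-line-gk2-p4` g24 (WIDTH-5 attach, cell `bsd-f1-sign2`), `--supports stmt-BirchSwinnertonDyer-23379 --as helper`.
THEOREMS ONLY (no definition, no named fact, no `sorry`).  BSD is NOT proved by any of this; L⁺_T / Q4_T are NOT claimed; nothing is closed.

WHY.  The K-side capstone of road (E4) (`pow_dvd_natCard_sha_of_kolyvaginSupplies_of_orthogonal_of_rank_le_one`, p741898) is sign-free; its
Kolyvagin supplies come from gk2-p2 g19's assembly `exists_recordLevel_avoiding_of_deepSwap` over three sockets, the third of which is, VERBATIM,
`hK : ∀ ℓ, (Zhang–Kolyvagin ℓ ∧ L ≤ index ℓ) ∧ G ℓ → ∀ C ≤ H¹(K, E[2^L]), (∀ c ∈ C, c Selmer ∧ τ_* c = (−w(E)·(−1)^r) • c) →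
(⨅_{v ∋ ℓ} torsionLocalKer_v).relIndex (C ⊓ H¹[2]) ∣ 2`.  On `Δ < 0` it is gk2-p5 g23's `relIndex_iInf_torsionLocalKer_inf_torsionBy_two_dvd_two`
(`…RTEigenIndexTwoKolyvaginPrime`, p723289) at the Gross primes `FrobEqFrobInfty W K (2^L) ℓ`, whose ONLY uses of `Δ < 0` / (3.2) are: the witness
`h = c₀ · res g` with `g ∈ Γ_{K(E[2^L])}`, and `c₀` moving a point of `E[2]` (`exists_twoTorsion_smul_ne_of_Δ_neg`).  On `Δ > 0` complex conjugation
fixes `E[2]` (`…PosTComplexConjugationNotRegular`) and the road runs at REGULAR Kolyvagin primes (LEAD R10 §0.3, gk2-p2 g22's (β″-mirror) clause,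
gk2-p4 g23's Part C `RegularSigned.exists_regular_kolyvaginPrime_fullOrder_signedPair_of_heegner`): an arithmetic Frobenius `h` above `ℓ` acting on `K`
as a complex conjugation `c₀` and on `E[2^L]` as an involution moving a point of `E[2]`.  THIS FILE proves the law there:
* §1 `exists_frobenius_conjGalCMH_mul_of_isArithFrobAt_of_smul_eq` — for ANY `h ∈ Γ_ℚ` Frobenius above `ℓ ∤ d_K` acting on `K` as `c₀`:
  `h = c₀ · res g` (`g ∈ Γ_K`, NOT torsion-fixing in general) and `g^τ̃ g` (`τ̃ = e c₀ e⁻¹`) is an arithmetic Frobenius at a prime `𝔔` of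
  `\bar ℤ_K` above the unique place `w ∋ ℓ` of `K` (Steps F–G of McCallum Cor. 3.2, as in p723289 §1, minus the torsion clause);
* §2 `h1Eval_conjAct_conjGalCMH_mul_of_mem` — `[τ_* c, g^τ̃ g] = τ̃ (g • [c, g^τ̃ g])` whenever `g^τ̃ g ∈ Γ_{K(E[n])}`: `(g^τ̃ g)^τ̃ = g (g^τ̃ g) g⁻¹` and
  `[c, g F g⁻¹] = g • [c, F]` (`h1Eval_conj`) — evaluation at that Frobenius intertwines `τ_*` with the involution `τ̃_E ∘ g_E = h_E` of `E(K̄)[n]`;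
* §3 **`relIndex_iInf_torsionLocalKer_inf_torsionBy_two_dvd_two_regular`** — p723289's theorem with `(hΔ : W.Δ < 0)` DELETED and
  `FrobEqFrobInfty W K (2^L) ℓ` REPLACED by the regular clause
  `∃ v 𝔓 (h c₀ : Γ_ℚ), ℓ ∈ v ∧ 𝔓 ∈ v.primesAbove ∧ IsArithFrobAt (𝓞 ℚ) h 𝔓 ∧ IsComplexConjugation c₀ ∧ (∀ X : E[2^L], h • h • X = X) ∧
   (∃ u : E[2], h • u ≠ u) ∧ ∀ e z, h • e z = c₀ • e z`;
  proof = p723289's with the frame `E(K̄)[2^L] = ℤ·θP₀ ⊕ ℤ·h_E θP₀` built from the moved `2`-torsion point (`pow_dvd_of_zsmul_add_zsmul_smul_eq_zero`,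
  spanning by counting) for the involution `h_E = τ̃_E ∘ g_E`, and LEAD g15's `relIndex_ker_inf_torsionBy_two_dvd_two`;
The companion `…PosTEigenIndexTwoRegularSocket` reduces the regular clause, at a Zhang–Kolyvagin prime of index `≥ L`, to gk2-p2 g22's (β″-mirror)
witness clause «some arithmetic Frobenius above `ℓ` moves a point of `E[2]`» and states the plug forms in the KS assembly's currency.

HONEST FRAMING.  Pure port of p723289 (gk2-p5 g23) / p727553 (gk2-p5 g24) to the regular primes of LINE 19; closes nothing; BSD is not proved.

References: [McCallumLMS1991] §3 (3), Prop. 3.1 (proof), Cor. 3.2, §5 proof of Prop. 5.2, Lemma 5.3; [GrossLMS1991] §3 (3.1)–(3.3), §9 Prop. 9.6;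
[SilvermanAEC2009] Cor. III.6.4(b), Cor. X.4.4.
-/

set_option autoImplicit false
-- `Summit.<P>.<Sub>` repeats `BirchSwinnertonDyer` by the tree's layout convention (D-0017)
set_option linter.dupNamespace false

noncomputable section

open scoped Classical

namespace Summit.BirchSwinnertonDyer.BirchSwinnertonDyer.Theorems.GenusExact.PlusDescent

open WeierstrassCurve NumberField IsDedekindDomain Field
open Literature.NumberTheory.GaloisRepresentations Literature.NumberTheory.EllipticCurves
open Summit.BirchSwinnertonDyer.BirchSwinnertonDyer.Theorems.PrintCFram.BorelKolyvaginPairing (isUnramifiedIn_of_not_dvd_discr)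

variable (W : WeierstrassCurve ℚ) [W.IsElliptic] {K : Type} [Field K] [NumberField K]

/-! ## §1 The Frobenius at the place of a prime whose Frobenius is complex conjugation on `K` is `g^τ̃ g` -/

/-- **The Frobenius over `K` at a prime whose rational Frobenius acts on `K` as complex conjugation is `g^τ̃ g`.**  `K` imaginary
quadratic with non-trivial automorphism `c`; `ℓ ∤ d_K` prime; `h ∈ Γ_ℚ` an arithmetic Frobenius at a prime `𝔓₀ ∣ ℓ` of `\bar ℤ` acting on
(every embedded copy of) `K` as the complex conjugation `c₀`.  Then `h = c₀ · res g` for some `g ∈ Γ_K` (NO condition on the torsion action of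
`g`), and for the involutive lift `τ̃ = e c₀ e⁻¹` of `c`: the place `w ∋ ℓ` of `K` is unique and carries a prime `𝔔 ∣ w` of `\bar ℤ_K` at which
**`g^τ̃ g` is an arithmetic Frobenius**.  (p723289 §1 = Steps F–G of McCallum Cor. 3.2 run on `h`; the torsion clause dropped.)
[cite: McCallumLMS1991, §3 Prop. 3.1 (proof), Cor. 3.2] [cite: GrossLMS1991, §3 (3.2)] -/
theorem exists_frobenius_conjGalCMH_mul_of_isArithFrobAt_of_smul_eq (hK : IsImaginaryQuadratic K)
    {c : K ≃ₐ[ℚ] K} (hc : c ≠ 1) {ℓ : ℕ} (hℓ : ℓ.Prime) (hℓD : ¬ ((ℓ : ℤ) ∣ NumberField.discr K))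
    {v : HeightOneSpectrum (𝓞 ℚ)} {𝔓₀ : Ideal (absIntegers (𝓞 ℚ) ℚ)} {h c₀ : absoluteGaloisGroup ℚ}
    (hℓv : (ℓ : 𝓞 ℚ) ∈ v.asIdeal) (h𝔓₀ : 𝔓₀ ∈ v.primesAbove) (hh : IsArithFrobAt (𝓞 ℚ) h 𝔓₀)
    (hc₀ : IsComplexConjugation (Rat.castHom ℝ) c₀)
    (hKx : ∀ (e : K →ₐ[ℚ] AlgebraicClosure ℚ) (x : K), h • e x = c₀ • e x) :
    ∃ (ht : IsLiftOfAut c (absGaloisTransport (K := ℚ) (L := K) c₀).toRingEquiv)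
      (w : HeightOneSpectrum (𝓞 K)) (𝔔 : Ideal (absIntegers (𝓞 K) K)) (g : absoluteGaloisGroup K),
      w.under (𝓞 ℚ) = v ∧ (ℓ : 𝓞 K) ∈ w.asIdeal ∧
        (∀ w' : HeightOneSpectrum (𝓞 K), (ℓ : 𝓞 K) ∈ w'.asIdeal → w' = w) ∧
        𝔔 ∈ w.primesAbove ∧ IsArithFrobAt (𝓞 K) (ht.conjGalCMH g * g) 𝔔 ∧
        h = c₀ * absGaloisRestrict ℚ K g := by
  -- (adapted from p723289 `exists_frobenius_conjGalCMH_mul_of_frobEqFrobInfty_at`, gk2-p5 g23)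
  haveI : Algebra.IsQuadraticExtension ℚ K := ⟨hK.1⟩
  haveI : IsTotallyComplex K := hK.2
  have ht : IsLiftOfAut c (absGaloisTransport (K := ℚ) (L := K) c₀).toRingEquiv :=
    RatClosure.isLiftOfAut_absGaloisTransport_of_isImaginaryQuadratic hK hc hc₀
  -- `h = c₀ · res g`, `g ∈ Γ_K` (the pointwise stabiliser of the embedded `K` is `res(Γ_K)`)
  have hmem : c₀⁻¹ * h ∈ (absGaloisRestrict ℚ K).range := by
    rw [mem_range_absGaloisRestrict_iff_smul_absEmbedding]
    intro x
    have hx := hKx (absEmbedding ℚ K) x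
    calc (c₀⁻¹ * h) • absEmbedding ℚ K x = c₀⁻¹ • (h • absEmbedding ℚ K x) := mul_smul _ _ _
      _ = c₀⁻¹ • (c₀ • absEmbedding ℚ K x) := congrArg (c₀⁻¹ • ·) hx
      _ = absEmbedding ℚ K x := inv_smul_smul _ _
  obtain ⟨g, hg⟩ := hmem
  have hhg : h = c₀ * absGaloisRestrict ℚ K g := by
    rw [show absGaloisRestrict ℚ K g = c₀⁻¹ * h from hg, mul_inv_cancel_left]
  -- Step F of the tree: `ℓ` is inert with Frobenius `τ' = g^τ̃ g` over `K`
  have hunr : Algebra.IsUnramifiedIn (𝓞 K) v.asIdeal := isUnramifiedIn_of_not_dvd_discr hℓ hℓD hℓv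
  have hHi := index_range_absGaloisRestrict_eq_finrank ℚ K
  haveI hHn : ((absGaloisRestrict ℚ K).range).Normal := Subgroup.normal_of_index_eq_two (hHi.trans hK.1)
  have hI := inertia_le_range_absGaloisRestrict_of_isUnramifiedIn (K := K) hunr h𝔓₀
  have hΦH : h ∉ (absGaloisRestrict ℚ K).range := by
    intro hmem'
    apply hc₀.not_mem_range_absGaloisRestrict (L := K) IsTotallyComplex.isComplex
    change c₀ ∈ ((absGaloisRestrict ℚ K).range : Set (absoluteGaloisGroup ℚ))
    have h' : c₀ = h * (absGaloisRestrict ℚ K g)⁻¹ := by rw [hhg]; group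
    rw [SetLike.mem_coe, h']
    exact Subgroup.mul_mem _ hmem' (Subgroup.inv_mem _ ⟨g, rfl⟩)
  obtain ⟨w, 𝔔, τ', hwv, hwuniq, -, h𝔔w, -, hτ', hresτ'⟩ :=
    exists_place_inert_of_not_mem_range (F := ℚ) (M := K) (hK.1 ▸ Nat.prime_two) hHn (hHi.trans rfl) hunr h𝔓₀ hI hh hΦH
  rw [hK.1, hhg, sq_eq_absGaloisRestrict_conjGal_mul hc₀ ht g] at hresτ'
  have hτ'eq : τ' = ht.conjGalCMH g * g := absGaloisRestrict_injective ℚ K hresτ'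
  -- `ℓ ∈ w`, and `w` is the only place of `K` containing `ℓ`
  have hℓw : (ℓ : 𝓞 K) ∈ w.asIdeal := by
    have h1 : (ℓ : 𝓞 ℚ) ∈ (w.under (𝓞 ℚ)).asIdeal := by rw [hwv]; exact hℓv
    rw [HeightOneSpectrum.under_asIdeal, Ideal.under_def, Ideal.mem_comap, map_natCast] at h1
    exact h1
  have hwuniq' : ∀ w' : HeightOneSpectrum (𝓞 K), (ℓ : 𝓞 K) ∈ w'.asIdeal → w' = w := by
    intro w' hw'
    apply hwuniq
    apply HeightOneSpectrum.eq_of_natCast_mem_rat hℓ _ hℓv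
    rw [HeightOneSpectrum.under_asIdeal, Ideal.under_def, Ideal.mem_comap, map_natCast]
    exact hw'
  exact ⟨ht, w, 𝔔, g, hwv, hℓw, hwuniq', h𝔔w, hτ'eq ▸ hτ', hhg⟩

/-! ## §2 Evaluation at `g^τ̃ g` intertwines `τ_*` with `τ̃_E ∘ g_E` -/

omit [W.IsElliptic] in
/-- **`[σ_* c, g^τ̃ g] = τ̃ (g • [c, g^τ̃ g])`** for an involutive lift `τ̃` of `σ ∈ Aut(K/ℚ)` and ANY `g ∈ Γ_K` such that `F = g^τ̃ g` fixes
`E(K̄)[n]`: `[σ_* c, F] = τ̃ [c, F^τ̃]` (`IsLiftOfAut.h1Eval_conjAct`), `F^τ̃ = g g^τ̃ = g F g⁻¹` (`conjGalCMH` is a homomorphism and an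
involution), and `[c, g F g⁻¹] = g • [c, F]` (`h1Eval_conj`).  So evaluation at `F` intertwines `σ_*` on `H¹(K, E[n])` with the endomorphism
`τ̃_E ∘ g_E` of `E(K̄)[n]` — the transport of `h = c₀ · res g`.  (For `g ∈ Γ_{K(E[n])}` this is p723289's `h1Eval_conjAct_conjGalCMH_mul`.)
[cite: McCallumLMS1991, §3 proof of Prop. 3.1] [cite: GrossLMS1991, §9 (pairing after Prop. 9.1)] -/
theorem h1Eval_conjAct_conjGalCMH_mul_of_mem {σ : K ≃ₐ[ℚ] K} {τ : AlgebraicClosure K ≃+* AlgebraicClosure K}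
    (hτ : IsLiftOfAut σ τ) (hinv : ∀ x, τ (τ x) = x) (n : ℤ) {g : absoluteGaloisGroup K}
    (hF : hτ.conjGalCMH g * g ∈ torsionFixing (W.baseChange K) n) (c : galH1Torsion (W.baseChange K) n) :
    h1Eval (W.baseChange K) n (conjAct W σ n c) (hτ.conjGalCMH g * g) =
      hτ.torsionMap W n (g • h1Eval (W.baseChange K) n c (hτ.conjGalCMH g * g)) := by
  have hconj : hτ.conjGalCMH (hτ.conjGalCMH g * g) = g * (hτ.conjGalCMH g * g) * g⁻¹ := by
    rw [map_mul, hτ.conjGalCMH_conjGalCMH hinv, ← mul_assoc, mul_inv_cancel_right]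
  rw [hτ.h1Eval_conjAct W n c hF, hconj, h1Eval_conj (W.baseChange K) n c g hF]

/-! ## §3 The index of the strict condition at a REGULAR Kolyvagin prime on the `2`-torsion of eigen Selmer classes -/

/-- **hK⁺ IN ARITHMETIC CURRENCY: at a REGULAR Kolyvagin prime the strict local condition has index `∣ 2` on `C[2]` for a `τ`-EIGEN
subgroup `C` of Selmer classes.**  `W/ℚ` elliptic (ANY sign of `Δ`); `K` imaginary quadratic with non-trivial automorphism `τ`; `L ≥ 1`; `ℓ` a
prime with `ℓ ≠ 2`, `ℓ ∤ d_K`, good reduction, and the REGULAR clause: an arithmetic Frobenius `h ∈ Γ_ℚ` above `ℓ` acting on (every embedded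
copy of) `K` as a complex conjugation `c₀`, as an involution on `E[2^L]`, and MOVING a point of `E[2]`; `ε = ±1`; `C ≤ H¹(K, E[2^L])` a subgroup
of SELMER classes with `τ_* c = ε • c`.  Then `A ℓ = ⨅_{v ∋ ℓ} ker (H¹(K, E[2^L]) → H¹(K_v, E[2^L]))` satisfies
**`(A ℓ).relIndex (C ⊓ H¹(K,E[2^L])[2]) ∣ 2`**.  p723289's `relIndex_iInf_torsionLocalKer_inf_torsionBy_two_dvd_two` with `Δ < 0` deleted and
`FrobEqFrobInfty W K (2^L) ℓ` replaced by the regular clause; proof = p723289's: §1 gives `h = c₀ · res g` and the Frobenius `F = g^τ̃ g` at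
`𝔔 ∣ w ∋ ℓ` (it fixes `E(K̄)[2^L]` because `res F = h²`); Selmer classes are unramified at the good place `w ∤ 2^L`, so on `C` the strict condition
is `[c, F] = 0` (`torsionLocalKer_iff_h1Eval_of_isArithFrobAt`); `[·, F]` intertwines `τ_*` with the involution `h_E = τ̃_E ∘ g_E` of `E(K̄)[2^L]`
(§2), which is free of rank one over `ℤ/2^L[h_E]` on a `2^{L−1}`-th root of the moved `2`-torsion point (`pow_dvd_of_zsmul_add_zsmul_smul_eq_zero`,
spanning by counting); LEAD g15's `relIndex_ker_inf_torsionBy_two_dvd_two` concludes.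
[cite: McCallumLMS1991, §3 (3), §5 proof of Prop. 5.2, Lemma 5.3] [cite: GrossLMS1991, §3 (3.1)–(3.3), Prop. 9.6] -/
theorem relIndex_iInf_torsionLocalKer_inf_torsionBy_two_dvd_two_regular (hK : IsImaginaryQuadratic K)
    {τ : K ≃ₐ[ℚ] K} (hτ : τ ≠ 1) {L : ℕ} (hL : 1 ≤ L) {ℓ : ℕ} [hℓF : Fact ℓ.Prime] (hℓ2 : ℓ ≠ 2)
    (hℓD : ¬ ((ℓ : ℤ) ∣ NumberField.discr K)) (hgood : W.HasGoodReductionAtPrime ℓ)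
    (hreg : ∃ (v : HeightOneSpectrum (𝓞 ℚ)) (𝔓 : Ideal (absIntegers (𝓞 ℚ) ℚ)) (h c₀ : absoluteGaloisGroup ℚ),
      (ℓ : 𝓞 ℚ) ∈ v.asIdeal ∧ 𝔓 ∈ v.primesAbove ∧ IsArithFrobAt (𝓞 ℚ) h 𝔓 ∧
        IsComplexConjugation (Rat.castHom ℝ) c₀ ∧
        (∀ X : geomTorsion W ((2 ^ L : ℕ) : ℤ), h • h • X = X) ∧ (∃ u : geomTorsion W 2, h • u ≠ u) ∧
        ∀ (e : K →ₐ[ℚ] AlgebraicClosure ℚ) (z : K), h • e z = c₀ • e z)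
    {ε : ℤ} (hε : ε = 1 ∨ ε = -1)
    (C : AddSubgroup (galH1Torsion (W.baseChange K) ((2 ^ L : ℕ) : ℤ)))
    (hC : ∀ c ∈ C, c ∈ selmerGroup (W.baseChange K) ((2 ^ L : ℕ) : ℤ) ∧
      conjAct W τ ((2 ^ L : ℕ) : ℤ) c = ε • c) :
    (⨅ (v : HeightOneSpectrum (𝓞 K)) (_ : (ℓ : 𝓞 K) ∈ v.asIdeal),
        (W.baseChange K).torsionLocalKer (v.adicCompletion K) ((2 ^ L : ℕ) : ℤ)).relIndex
      (C ⊓ AddSubgroup.torsionBy (galH1Torsion (W.baseChange K) ((2 ^ L : ℕ) : ℤ)) (2 : ℤ)) ∣ 2 := by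
  -- (adapted from p723289 `relIndex_iInf_torsionLocalKer_inf_torsionBy_two_dvd_two`, gk2-p5 g23)
  have hℓ : ℓ.Prime := hℓF.out
  haveI : (W.baseChange K).IsElliptic := by rw [baseChange]; infer_instance
  have hp : Nat.Prime 2 := Nat.prime_two
  have hn : (2 ^ L : ℕ) ≠ 0 := pow_ne_zero L two_ne_zero
  obtain ⟨v, 𝔓₀, h, c₀, hℓv, h𝔓₀, hh, hc₀, hhh, ⟨t₂, ht₂⟩, hKx⟩ := hreg
  -- ### §1: `h = c₀ · res g` and the Frobenius `F = g^τ̃ g` at `𝔔 ∣ w ∋ ℓ`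
  obtain ⟨ht, w, 𝔔, g, hwv, hℓw, hwuniq, h𝔔w, hF, hhg⟩ :=
    exists_frobenius_conjGalCMH_mul_of_isArithFrobAt_of_smul_eq hK hτ hℓ hℓD hℓv h𝔓₀ hh hc₀ hKx
  have hinv : ∀ x, (absGaloisTransport (K := ℚ) (L := K) c₀).toRingEquiv
      ((absGaloisTransport (K := ℚ) (L := K) c₀).toRingEquiv x) = x := fun x ↦
    RatClosure.absGaloisTransport_absGaloisTransport_of_sq_eq_one hc₀.sq_eq_one x
  -- ### transport `θ : E(ℚ̄)[2^L] ≃ E(K̄)[2^L]`: `θ (res g • P) = g • θ P`, `θ (c₀ • P) = τ̃_E (θ P)`, `θ (h • P) = τ̃_E (g • θ P)`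
  set θ := RatClosure.torsionEquiv (K := K) W ((2 ^ L : ℕ) : ℤ) with hθ
  have hθg : ∀ (g' : absoluteGaloisGroup K) (P : geomTorsion W ((2 ^ L : ℕ) : ℤ)),
      θ (absGaloisRestrict ℚ K g' • P) = g' • θ P := fun g' P ↦ RatClosure.torsionEquiv_smul W _ g' P
  have hθc : ∀ P : geomTorsion W ((2 ^ L : ℕ) : ℤ), θ (c₀ • P) = ht.torsionMap W ((2 ^ L : ℕ) : ℤ) (θ P) := fun P ↦
    RatClosure.torsionEquiv_smul_of_lift W ht c₀ (fun _ ↦ rfl) _ P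
  have hθh : ∀ P : geomTorsion W ((2 ^ L : ℕ) : ℤ), θ (h • P) = ht.torsionMap W ((2 ^ L : ℕ) : ℤ) (g • θ P) := fun P ↦ by
    rw [hhg, mul_smul, hθc, hθg]
  -- ### `F = g^τ̃ g` fixes `E(K̄)[2^L]`: `res F = h²`
  have hFT : ht.conjGalCMH g * g ∈ torsionFixing (W.baseChange K) ((2 ^ L : ℕ) : ℤ) := by
    refine (mem_torsionFixing_iff _ _).mpr fun Q ↦ ?_
    obtain ⟨P, rfl⟩ := θ.surjective Q
    rw [← hθg, ← sq_eq_absGaloisRestrict_conjGal_mul hc₀ ht g, ← hhg, pow_two, mul_smul, hhh]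
  -- ### the involution `t = τ̃_E ∘ g_E` of `E(K̄)[2^L]` (the transport of `h`)
  set t : geomTorsion (W.baseChange K) ((2 ^ L : ℕ) : ℤ) →+ geomTorsion (W.baseChange K) ((2 ^ L : ℕ) : ℤ) :=
    (ht.torsionMap W ((2 ^ L : ℕ) : ℤ)).comp (DistribSMul.toAddMonoidHom (geomTorsion (W.baseChange K) ((2 ^ L : ℕ) : ℤ)) g)
    with htdef
  have ht_apply : ∀ Q, t Q = ht.torsionMap W ((2 ^ L : ℕ) : ℤ) (g • Q) := fun Q ↦ rfl
  have htθ : ∀ P : geomTorsion W ((2 ^ L : ℕ) : ℤ), t (θ P) = θ (h • P) := fun P ↦ by rw [ht_apply, hθh]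
  have htt : ∀ Q, t (t Q) = Q := fun Q ↦ by
    obtain ⟨P, rfl⟩ := θ.surjective Q
    rw [htθ, htθ, hhh]
  -- ### good reduction of `E_K` at `w`, and `w ∤ 2^L`
  haveI : w.asIdeal.LiesOver v.asIdeal := ⟨by rw [← hwv]; rfl⟩
  have hgoodv : W.HasGoodReductionAt v := VisiblePairAtTwo.hasGoodReductionAt_of_hasGoodReductionAtPrime W hgood hℓv
  have hgoodw : (W.baseChange K).HasGoodReductionAt w :=
    hasGoodReductionAt_baseChange_of_hasGoodReductionAt W K v w hgoodv
  have hwbad : w ∉ (W.baseChange K).badPlaces (𝓞 K) := fun h ↦ h hgoodw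
  have h2w : ((2 : ℕ) : 𝓞 K) ∉ w.asIdeal := not_natCast_mem_of_prime_ne hℓ hp hℓ2 w hℓw
  have hnw : ((((2 ^ L : ℕ) : ℤ)) : 𝓞 K) ∉ w.asIdeal := fun h ↦ by
    apply h2w
    rw [Int.cast_natCast, Nat.cast_pow] at h
    exact w.isPrime.mem_of_pow_mem L h
  -- ### Selmer classes are unramified at the primes above `w`; the local criterion on `C`
  have hunr : ∀ c : C, ∀ 𝔓 ∈ w.primesAbove,
      (c : galH1Torsion (W.baseChange K) ((2 ^ L : ℕ) : ℤ)) ∈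
        unramifiedKer (geomTorsion (W.baseChange K) ((2 ^ L : ℕ) : ℤ)) 𝔓 := by
    intro c 𝔓 h𝔓
    exact selmerLocalKer_le_unramifiedKer (HeightOneSpectrum.exists_mem_inertia_apply_eq_holds w)
      (W.baseChange K).smul_localPoints_eq_of_mem_inertia_holds hwbad hnw h𝔓
      (((mem_selmerGroup_iff (W.baseChange K) _ (c : galH1Torsion (W.baseChange K) ((2 ^ L : ℕ) : ℤ))).mp
        (hC c c.2).1).1 w)
  have hcl : AddSubgroup.closure (Set.range (fun c : C ↦ (c : galH1Torsion (W.baseChange K) ((2 ^ L : ℕ) : ℤ)))) = C := by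
    rw [show Set.range (fun c : C ↦ (c : galH1Torsion (W.baseChange K) ((2 ^ L : ℕ) : ℤ))) = (C : Set _) from
      Subtype.range_coe, AddSubgroup.closure_eq]
  have hcrit : ∀ c ∈ C, (c ∈ (W.baseChange K).torsionLocalKer (w.adicCompletion K) ((2 ^ L : ℕ) : ℤ) ↔
      h1Eval (W.baseChange K) ((2 ^ L : ℕ) : ℤ) c (ht.conjGalCMH g * g) = 0) := by
    intro c hc
    exact torsionLocalKer_iff_h1Eval_of_isArithFrobAt W hn h𝔔w hF hFT hwbad hnw hunr (by rw [hcl]; exact hc)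
  -- ### the free generator of `E(ℚ̄)[2^L]` over `ℤ/2^L[h]`: a `2^{L-1}`-th root `P₀` of the MOVED `2`-torsion point `t₂`
  have ht₂2 : (2 : ℤ) • (t₂ : geomPoints W) = 0 := (mem_geomTorsion_iff W 2 (t₂ : geomPoints W)).mp t₂.2
  have hct₂ : h • (t₂ : geomPoints W) ≠ (t₂ : geomPoints W) := fun e ↦ ht₂ (Subtype.ext e)
  have hq0 : (((2 ^ (L - 1) : ℕ) : ℤ)) ≠ 0 := by positivity
  obtain ⟨P, hP⟩ := W.zsmul_geomPoints_surjective_of_charZero hq0 (t₂ : geomPoints W)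
  have hPv : ((2 ^ (L - 1) : ℕ) : ℤ) • P = (t₂ : geomPoints W) := hP
  have hPM : P ∈ geomTorsion W ((2 ^ L : ℕ) : ℤ) := by
    rw [mem_geomTorsion_iff]
    have h2M : ((2 ^ L : ℕ) : ℤ) = 2 * ((2 ^ (L - 1) : ℕ) : ℤ) := by
      push_cast
      rw [← pow_succ', Nat.sub_add_cancel hL]
    rw [h2M, mul_smul, hPv, ht₂2]
  set P₀ : geomTorsion W ((2 ^ L : ℕ) : ℤ) := ⟨P, hPM⟩ with hP₀
  have hfree₀ : ∀ a b : ℤ, a • P₀ + b • (h • P₀) = 0 → (2 : ℤ) ^ L ∣ a ∧ (2 : ℤ) ^ L ∣ b := by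
    intro a b hab
    have hab' : a • P + b • (h • P) = 0 := congrArg Subtype.val hab
    have hPM' : (2 : ℤ) ^ L • P = 0 := by
      have h := (mem_geomTorsion_iff W _ P).mp hPM
      push_cast at h
      exact h
    have hPv' : (2 : ℤ) ^ (L - 1) • P = (t₂ : geomPoints W) := by
      have h := hPv
      push_cast at h
      exact h
    exact pow_dvd_of_zsmul_add_zsmul_smul_eq_zero ht₂2 hct₂ L P hPM' hPv' a b hab'
  -- ### transported to `E(K̄)[2^L]`, where `h` acts as `t`
  have hA : ∀ Q : geomTorsion (W.baseChange K) ((2 ^ L : ℕ) : ℤ), ((2 ^ L : ℕ) : ℤ) • Q = 0 := fun Q ↦ by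
    apply Subtype.ext
    rw [AddSubgroupClass.coe_zsmul, ZeroMemClass.coe_zero]
    exact (mem_geomTorsion_iff (W.baseChange K) _ (Q : geomPoints (W.baseChange K))).mp Q.2
  have htor : (2 ^ L : ℤ) • θ P₀ = 0 := by exact_mod_cast hA (θ P₀)
  have hfree : ∀ a b : ℤ, a • θ P₀ + b • t (θ P₀) = 0 → (2 ^ L : ℤ) ∣ a ∧ (2 ^ L : ℤ) ∣ b := by
    intro a b hab
    rw [htθ, ← map_zsmul, ← map_zsmul, ← map_add, map_eq_zero_iff _ θ.injective] at hab
    exact hfree₀ a b hab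
  have hcard : Nat.card (geomTorsion (W.baseChange K) ((2 ^ L : ℕ) : ℤ)) = (2 ^ L) ^ 2 :=
    card_torsionPoints_eq_sq_holds (W.baseChange K) (AlgebraicClosure K) (by exact_mod_cast hn)
  have hspan : ∀ Q : geomTorsion (W.baseChange K) ((2 ^ L : ℕ) : ℤ), ∃ a b : ℤ, Q = a • θ P₀ + b • t (θ P₀) :=
    exists_eq_zsmul_add_zsmul_of_indep hL hA hcard hfree
  -- ### LEAD's algebra: `ker [·, F]` has index `∣ 2` on `C[2]`
  have hequiv : ∀ c, h1EvalHom (W.baseChange K) ((2 ^ L : ℕ) : ℤ) hFT (conjAct W τ ((2 ^ L : ℕ) : ℤ) c) =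
      t (h1EvalHom (W.baseChange K) ((2 ^ L : ℕ) : ℤ) hFT c) := fun c ↦ by
    rw [h1EvalHom_apply, h1EvalHom_apply, ht_apply]
    exact h1Eval_conjAct_conjGalCMH_mul_of_mem W ht hinv _ hFT c
  have hker := relIndex_ker_inf_torsionBy_two_dvd_two t htt hL (θ P₀) hspan hfree htor (conjAct W τ ((2 ^ L : ℕ) : ℤ))
    (h1EvalHom (W.baseChange K) ((2 ^ L : ℕ) : ℤ) hFT) hequiv C hε (fun c hc ↦ (hC c hc).2)
  -- ### on `C`, the strict condition at the places over `ℓ` IS `ker [·, F]`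
  have hsub : (⨅ (v : HeightOneSpectrum (𝓞 K)) (_ : (ℓ : 𝓞 K) ∈ v.asIdeal),
        (W.baseChange K).torsionLocalKer (v.adicCompletion K) ((2 ^ L : ℕ) : ℤ)).addSubgroupOf
        (C ⊓ AddSubgroup.torsionBy (galH1Torsion (W.baseChange K) ((2 ^ L : ℕ) : ℤ)) (2 : ℤ)) =
      (h1EvalHom (W.baseChange K) ((2 ^ L : ℕ) : ℤ) hFT).ker.addSubgroupOf
        (C ⊓ AddSubgroup.torsionBy (galH1Torsion (W.baseChange K) ((2 ^ L : ℕ) : ℤ)) (2 : ℤ)) := by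
    ext ⟨x, hx⟩
    have hxC : x ∈ C := (AddSubgroup.mem_inf.mp hx).1
    simp only [AddSubgroup.mem_addSubgroupOf, AddSubgroup.mem_iInf, AddMonoidHom.mem_ker, h1EvalHom_apply]
    rw [← hcrit x hxC]
    exact ⟨fun h ↦ h w hℓw, fun h v' hv' ↦ by rw [hwuniq v' hv']; exact h⟩
  change ((⨅ (v : HeightOneSpectrum (𝓞 K)) (_ : (ℓ : 𝓞 K) ∈ v.asIdeal),
      (W.baseChange K).torsionLocalKer (v.adicCompletion K) ((2 ^ L : ℕ) : ℤ)).addSubgroupOf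
      (C ⊓ AddSubgroup.torsionBy (galH1Torsion (W.baseChange K) ((2 ^ L : ℕ) : ℤ)) (2 : ℤ))).index ∣ 2
  rw [hsub]
  exact hker

end Summit.BirchSwinnertonDyer.BirchSwinnertonDyer.Theorems.GenusExact.PlusDescent

end
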